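import Literature.NumberTheory.Automorphic.CDTTheorem722ThreeFactsProofs
import Literature.NumberTheory.Automorphic.CDTTheorem712ConductorStepProofs
import HarnessLib

/-!
# BCDT Theorem A by the three cases of the Introduction, from the four deep results it invokes —
# no Galois-side hypothesis left

Topic `NumberTheory/Automorphic`; a `…Proofs` companion (theorems only: no definitions, no named
facts, no instances) of `Literature.NumberTheory.Automorphic.BCDTTheoremACasesProofs`,
`…OggTwoProofs` and `…FactsProofs`, landed by the tenured seat of the named fact
`Literature.NumberTheory.Automorphic.exists_cuspForm_coeff_eq_frobeniusTrace` (**lang.S33**, the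
weak `a_p`-form of the Modularity Theorem) to re-point the switch-free assembly of that fact —
Theorem B kept whole, no auxiliary curve — after two of its leaves became theorems of the tree.

C. Breuil, B. Conrad, F. Diamond, R. Taylor, *On the modularity of elliptic curves over `ℚ`: wild
`3`-adic exercises*, J. Amer. Math. Soc. 14 (2001), 843–939 [BCDTJAMS2001], prove Theorem A
("every elliptic curve over `ℚ` is modular") in the Introduction (pp. 845–846) by three cases:
(1) `ρ̄_{E,5}|_{ℚ(√5)}` absolutely irreducible — Theorem B makes `ρ̄_{E,5}` modular and [CDT]
(Thm. 7.2.2) lifts; (2) otherwise but `ρ̄_{E,3}|_{ℚ(√-3)}` absolutely irreducible —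
Langlands–Tunnell and [CDT] (Thm. 7.2.1, which needs `27 ∤ N_E`: "in both cases `E` obtains
semi-stable reduction over a tame extension of `ℚ_ℓ`"); (3) neither — the finitely many
`j`-invariants of [CDT] Lemma 7.2.3.  `BCDTTheoremACasesProofs` formalised exactly this per curve
(`BCDT.isModular_of_theoremB_of_CDT721_722_723`), with the one arithmetic input of case (2),
`h27 : ρ̄_{E,5}|_{ℚ(√5)}` not absolutely irreducible ⇒ `27 ∤ N_E`, left abstract and then supplied
from Ogg's formula for the wild conductor at the additive places of residue characteristic `3`
(a named fact, at `ℓ = 5` there, at `ℓ = 2` in `…OggTwoProofs`).  Two inputs of that assembly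
have since been **proved** in the tree by other seats:

* Ogg's formula at `p = 3`, for every elliptic curve over every number field and every `ℓ`
  (`WeierstrassCurve.swanConductorAt_rationalTate_eq_wildConductorExponent_of_ringChar_eq_three_holds`,
  `Literature.NumberTheory.EllipticCurves.OggFormulaWildThreeProofs`), whence the hidden lemma
  `BCDT.not_twentySeven_dvd_conductorNorm_of_not_isAbsIrreducibleOverSqrt_five` and
  `BCDT.CDT_theorem_7_2_4_of_CDT712_722` with no hypothesis
  (`CDTTheorem712ConductorStepProofs`);
* Deligne–Serre 1974 (2.7.2) in weight `2`: `DeligneSerre1974_span_integralLattice1_holds`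
  (`DeligneSerreProp27LevelDescentProofs`), whence "(3) ⇒ (2)" and the reduction of CDT
  Thm. 7.2.2 to its `5`-adic lifting statement on THREE catalogued classical facts —
  Eichler–Shimura, Faltings, Carayol (`BCDT.CDT_theorem_7_2_2_of_lift_of_three_facts`,
  `CDTTheorem722ThreeFactsProofs`).

This file feeds both in (one-line compositions).  Results, none with a Galois-module, conductor
or `q`-expansion hypothesis:

* `BCDT.CDT_theorem_7_2_4_of_theoremB_of_7_2_1_of_7_2_2_of_7_2_3`,
  `BCDT.isModular_of_theoremB_of_CDT721_722_723'`,
  `BCDT.exists_isNewformOf_of_theoremB_of_CDT721_722_723` — **CDT Thm. 7.2.4 and BCDT Theorem A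
  (`exists_isNewformOf`, the Modularity Theorem in the tree's form) from exactly the four deep
  results the printed proof of Theorem A invokes**: Theorem B and, from [CDT], Thm. 7.2.1,
  Thm. 7.2.2, Lemma 7.2.3 — four catalogued named facts of the tree, nothing else;
  `BCDT.exists_isNewformOf_of_serre_of_CDT721_722_723` (Theorem B replaced by Serre's conjecture
  (3.2.3) at `p = 5`);
* `BCDT.CDT_theorem_7_2_4_of_theoremB_of_7_2_1_of_lift_of_7_2_3_of_three_facts`,
  `BCDT.isModular_of_theoremB_of_CDT721_lift_723_of_three_facts'`,
  `BCDT.exists_isNewformOf_of_theoremB_of_CDT721_lift_723_of_three_facts`,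
  `BCDT.exists_isNewformOf_of_serre_of_CDT721_lift_723_of_three_facts` — the same with CDT
  Thm. 7.2.2 unfolded into its two printed steps: the `5`-adic lifting statement `hlift` of CDT
  pp. 553–554 ("`ρ̄_{E,5}` modular and `ρ̄_{E,5}|_{ℚ(√5)}` absolutely irreducible ⇒ `ρ_{E,5}`
  modular", `WeierstrassCurve.IsModularGaloisRepTate`) and (3) ⇒ (2), the latter proved from
  Eichler–Shimura, Faltings and Carayol;
* `exists_cuspForm_coeff_eq_frobeniusTrace_of_theoremB_CDT712_722`,
  `exists_cuspForm_coeff_eq_frobeniusTrace_of_theoremB_of_CDT721_722_723` (+ the `L`-series form,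
  + the Serre variant),
  `exists_cuspForm_coeff_eq_frobeniusTrace_of_theoremB_of_CDT721_lift_723_of_three_facts` (+ the
  `L`-series form, + the Serre variant) — **lang.S33** on each of these inputs.

Trust bases of lang.S33 / `exists_isNewformOf` inside the tree after this file, each consisting of
catalogued named facts only: {`BCDT.theoremB`, `BCDT.CDT_theorem_7_1_2`, `BCDT.CDT_theorem_7_2_2`}
(BCDT §2.2: "Theorem A follows from Theorem B and Theorem 7.2.4 of [CDT]", 7.2.4 being "immediate
from Theorem 7.1.2"); {`BCDT.theoremB` (or `exists_newform_of_odd_irreducible` at `p = 5`),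
`BCDT.CDT_theorem_7_2_1`, `BCDT.CDT_theorem_7_2_2`, `BCDT.CDT_lemma_7_2_3_isModular`} (the three
cases of the Introduction); and, unfolding 7.2.2, {`BCDT.theoremB` (or Serre at `p = 5`),
`BCDT.CDT_theorem_7_2_1`, `BCDT.CDT_lemma_7_2_3_isModular`, `eichlerShimuraConstruction`,
`WeierstrassCurve.isIsogenous_iff_frobeniusTrace_eq`, `IsNewformOf.level_eq_conductorNorm`} plus the
one printed statement `hlift` (CDT Thm. 7.2.2, proof, pp. 553–554: Thm. 7.1.1 = Thm. 5.4.2 with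
Lemma 7.1.3, §2.2, §B.2, Prop. B.4.2), the part of [CDT] that needs the `p`-adic Hodge theory and
deformation theory absent from Mathlib.  Compared with `BCDTTheoremACasesFactsProofs` and
`CDTTheorem722ThreeFactsProofs` the inputs Deligne–Serre (2.7.2) and Ogg's formula at `p = 3` are
gone (proved); compared with `CDTTheorem712ConductorStepProofs` no `3`–`5` switch and no auxiliary
curve occur (Theorem B is kept whole).

## References

* [BCDTJAMS2001] C. Breuil, B. Conrad, F. Diamond, R. Taylor, J. Amer. Math. Soc. 14 (2001):
  Theorem A; Introduction, p. 845 (conditions (1)–(4), "(3) ⇒ (2) follows from a theorem of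
  Carayol [Ca1] and a theorem of Faltings [Fa2]"), pp. 845–846 (proof of Theorem A, cases 1–3);
  §2.2 (Thm. 2.2.2: "Theorem A follows from Theorem B and Theorem 7.2.4 of [CDT]").
* [ConradDiamondTaylor1999] B. Conrad, F. Diamond, R. Taylor, J. Amer. Math. Soc. 12 (1999):
  Thm. 7.1.2, Thm. 7.2.1, Thm. 7.2.2 (proof, pp. 553–554), Lemma 7.2.3, Thm. 7.2.4 (p. 556).
* [SilvermanATAEC1994] J. H. Silverman, *Advanced Topics in the Arithmetic of Elliptic Curves*,
  Thm. IV.11.1 (Ogg's formula) and its proof for `p = 3` (PDF pp. 366–371).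
* [DeligneSerreASENS1974] P. Deligne, J.-P. Serre, Ann. Sci. ÉNS 7 (1974), (2.7.2)–(2.7.4).
* [Knapp1993] A. W. Knapp, *Elliptic Curves*, Thm. 11.74, Thm. 12.8.
* [Faltings1983Endlichkeit] G. Faltings, Invent. Math. 73 (1983), §5 Korollar 2.
* [DiamondShurman2005] F. Diamond, J. Shurman, *A First Course in Modular Forms*, Thm. 8.8.1.

## Design

Theorems only; `noncomputable section`; namespaces `Literature.NumberTheory.Automorphic.BCDT`
(Theorem A / CDT forms) and `Literature.NumberTheory.Automorphic` (lang.S33 forms), as in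
`BCDTTheoremACasesFactsProofs`.  Primed names discharge the per-curve input `h27` of their unprimed
namesakes.  No new definitions, facts or instances.  Axioms of every theorem: `propext`,
`Classical.choice`, `Quot.sound`.
-/

noncomputable section

namespace Literature.NumberTheory.Automorphic.BCDT

open EllipticCurves EllipticCurves.ModularForms WeierstrassCurve GaloisRepresentations

/-! ## Theorem A from the four deep results of the Introduction: Thm. B, CDT 7.2.1, 7.2.2, 7.2.3 -/

/-- **Conrad–Diamond–Taylor 1999, Theorem 7.2.4** (the named fact `CDT_theorem_7_2_4`: `ρ̄_{E,5}`
modular ⇒ `E` modular) **from Theorem B, CDT Thm. 7.2.1, Thm. 7.2.2 and Lemma 7.2.3 — nothing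
else**: Thm. 7.2.4 is "immediate from Theorem 7.1.2" and Thm. 7.2.2 (p. 556;
`CDT_theorem_7_2_4_of_CDT712_722`, `CDTTheorem712ConductorStepProofs`, whose hidden lemma
"`ρ̄_{E,5}|_{ℚ(√5)}` not absolutely irreducible ⇒ `27 ∤ N_E`" is a theorem of the tree since Ogg's
formula at `p = 3` was proved), and Thm. 7.1.2 follows from Theorem B, 7.2.1, 7.2.2, 7.2.3 by the
three cases of BCDT's Introduction (`CDT_theorem_7_1_2_of_theoremB_of_7_2_1_of_7_2_2_of_7_2_3`,
`BCDTTheoremACasesProofs`).  The discharge of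
`CDT_theorem_7_2_4_of_theoremB_of_7_2_1_of_7_2_2_of_7_2_3_of_ogg3[two]`.
[cite: ConradDiamondTaylor1999, Thm. 7.2.4 (p. 556)]
[cite: BCDTJAMS2001, Introduction (proof of Theorem A, cases 1–3)] -/
theorem CDT_theorem_7_2_4_of_theoremB_of_7_2_1_of_7_2_2_of_7_2_3 (hB : theoremB)
    (h721 : CDT_theorem_7_2_1) (h722 : CDT_theorem_7_2_2) (h723 : CDT_lemma_7_2_3_isModular) :
    CDT_theorem_7_2_4 :=
  CDT_theorem_7_2_4_of_CDT712_722
    (CDT_theorem_7_1_2_of_theoremB_of_7_2_1_of_7_2_2_of_7_2_3 hB h721 h722 h723) h722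

/-- **BCDT, proof of Theorem A for a given `E / ℚ`: the three cases of the Introduction, from
Theorem B, CDT Thm. 7.2.1, Thm. 7.2.2 and Lemma 7.2.3 — nothing else.**  The unprimed
`isModular_of_theoremB_of_CDT721_722_723` (`BCDTTheoremACasesProofs`) with its per-curve input
`h27` ("`ρ̄_{E,5}|_{ℚ(√5)}` not absolutely irreducible ⇒ `27 ∤ N_E`": *"in both cases `E` obtains
semi-stable reduction over a tame extension of `ℚ_ℓ`"*) discharged by the tree's theorem
`not_twentySeven_dvd_conductorNorm_of_not_isAbsIrreducibleOverSqrt_five`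
(`CDTTheorem712ConductorStepProofs`: `27 ∣ N_E` forces, by Ogg's formula at the place `3` — now
proved — wild ramification of `E[5]` above `3`, hence an element of order `3` in the image of
`ρ̄_{E,5}`, hence absolute irreducibility over `ℚ(√5)` given the Weil pairing).  Case 1,
`ρ̄_{E,5}|_{ℚ(√5)}` absolutely irreducible: Theorem B, then CDT Thm. 7.2.2.  Case 2, not case 1 but
`ρ̄_{E,3}|_{ℚ(√-3)}` absolutely irreducible: `27 ∤ N_E`, then CDT Thm. 7.2.1 (Langlands–Tunnell
inside).  Case 3, neither: CDT Lemma 7.2.3 (Elkies).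
[cite: BCDTJAMS2001, Introduction (proof of Theorem A, cases 1–3)] -/
theorem isModular_of_theoremB_of_CDT721_722_723' (hB : theoremB) (h721 : CDT_theorem_7_2_1)
    (h722 : CDT_theorem_7_2_2) (h723 : CDT_lemma_7_2_3_isModular)
    (W : WeierstrassCurve ℚ) [W.IsElliptic] [NeZero (W.conductorNorm ℤ)] : IsModular W :=
  isModular_of_theoremB_of_CDT721_722_723 hB h721 h722 h723 W
    fun _ hρ h5 ↦ not_twentySeven_dvd_conductorNorm_of_not_isAbsIrreducibleOverSqrt_five W hρ h5

/-- **BCDT Theorem A** (`Literature.NumberTheory.EllipticCurves.ModularForms.exists_isNewformOf`,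
the Modularity Theorem in the tree's form: every elliptic `E / ℚ` has a newform `f` of level `N_E`
with `aₙ(f) = aₙ(E)`) **from exactly the four deep results its printed proof invokes — Theorem B
and, from [CDT], Thm. 7.2.1, Thm. 7.2.2, Lemma 7.2.3** (the three cases of the Introduction for
every curve, `isModular_of_theoremB_of_CDT721_722_723'`).  All four are catalogued named facts of
the tree; no `3`–`5` switch, no auxiliary curve, no conductor or Galois-module input.  The
discharge of `exists_isNewformOf_of_theoremB_of_CDT721_722_723_of_ogg3` (`BCDTTheoremACasesProofs`)
and `…_of_ogg3two` (`BCDTTheoremACasesOggTwoProofs`); compare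
`exists_isNewformOf_of_theoremB_CDT712_722` (`CDTTheorem712ConductorStepProofs`: Theorem B,
Thm. 7.1.2, Thm. 7.2.2) and `exists_isNewformOf_of_theoremB_CDT721_722_723_switch` (there; the
switch as a fifth input).
[cite: BCDTJAMS2001, Theorem A; Introduction (proof of Theorem A, cases 1–3)] -/
theorem exists_isNewformOf_of_theoremB_of_CDT721_722_723 (hB : theoremB)
    (h721 : CDT_theorem_7_2_1) (h722 : CDT_theorem_7_2_2) (h723 : CDT_lemma_7_2_3_isModular) :
    EllipticCurves.ModularForms.exists_isNewformOf :=
  fun W _ _ ↦ isModular_of_theoremB_of_CDT721_722_723' hB h721 h722 h723 W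

/-- **Theorem A from Serre's conjecture (3.2.3) at `p = 5` in place of Theorem B**, CDT Thm. 7.2.1,
Thm. 7.2.2 and Lemma 7.2.3 (modularity) — nothing else: Theorem B is the case `p = 5`,
`k = 𝔽₅ ⊂ 𝔽̄₅` of the named fact `exists_newform_of_odd_irreducible` (`SerreConjecture`; Serre
(3.2.3), Khare–Wintenberger 2009, Thm. 1.2) by `theoremB_of_exists_newform_of_odd_irreducible`
(`BCDTModularitySerreProofs`; BCDT, Introduction: *"Serre had earlier conjectured that ["`ρ̄`
irreducible ⇒ `ρ̄` modular"] holds"*).  Alternative trust base of the Modularity Theorem inside the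
tree: {Serre (3.2.3) at `p = 5`, `CDT_theorem_7_2_1`, `CDT_theorem_7_2_2`,
`CDT_lemma_7_2_3_isModular`}. [cite: BCDTJAMS2001, Introduction; Theorem A] -/
theorem exists_isNewformOf_of_serre_of_CDT721_722_723
    (hSerre : ∀ (k : Type) [Field k] [TopologicalSpace k] [DiscreteTopology k],
      exists_newform_of_odd_irreducible (p := 5) (k := k))
    (h721 : CDT_theorem_7_2_1) (h722 : CDT_theorem_7_2_2) (h723 : CDT_lemma_7_2_3_isModular) :
    EllipticCurves.ModularForms.exists_isNewformOf :=
  exists_isNewformOf_of_theoremB_of_CDT721_722_723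
    (theoremB_of_exists_newform_of_odd_irreducible hSerre) h721 h722 h723

/-! ## The same with CDT Thm. 7.2.2 unfolded: the `5`-adic lifting step, Eichler–Shimura,
Faltings, Carayol -/

/-- **Conrad–Diamond–Taylor 1999, Theorem 7.2.4 from Theorem B, CDT Thm. 7.2.1, the `5`-adic
lifting step of Thm. 7.2.2, Eichler–Shimura, Faltings, Carayol and Lemma 7.2.3** — no Ogg or
Galois-side input: `CDT_theorem_7_2_4_of_theoremB_of_7_2_1_of_7_2_2_of_7_2_3` with
`CDT_theorem_7_2_2` supplied by `CDT_theorem_7_2_2_of_lift_of_three_facts`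
(`CDTTheorem722ThreeFactsProofs`: (3) ⇒ (2) from the Eichler–Shimura construction
`eichlerShimuraConstruction`, Faltings' isogeny theorem
`WeierstrassCurve.isIsogenous_iff_frobeniusTrace_eq` and Carayol's theorem
`IsNewformOf.level_eq_conductorNorm`, Deligne–Serre (2.7.2) being proved).  The discharge of
`CDT_theorem_7_2_4_of_theoremB_of_7_2_1_of_lift_of_7_2_3_of_ogg3two_of_three_facts`.
[cite: ConradDiamondTaylor1999, Thm. 7.2.4 (p. 556) and Thm. 7.2.2 (proof, pp. 553–554)]
[cite: BCDTJAMS2001, Introduction (proof of Theorem A; (3) ⇒ (2))] -/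
theorem CDT_theorem_7_2_4_of_theoremB_of_7_2_1_of_lift_of_7_2_3_of_three_facts (hB : theoremB)
    (h721 : CDT_theorem_7_2_1)
    (hlift : ∀ (W : WeierstrassCurve ℚ) [W.IsElliptic] (ρ : ModPGaloisRep ℚ (ZMod 5) 2),
      W.IsTorsionGaloisRep 5 ρ → ρ.IsAbsIrreducibleOverSqrt 5 → ρ.IsModular →
      W.IsModularGaloisRepTate 5)
    (hES : eichlerShimuraConstruction)
    (hF : WeierstrassCurve.isIsogenous_iff_frobeniusTrace_eq)
    (hC : ∀ (N : ℕ) [NeZero N], IsNewformOf.level_eq_conductorNorm (N := N))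
    (h723 : CDT_lemma_7_2_3_isModular) :
    CDT_theorem_7_2_4 :=
  CDT_theorem_7_2_4_of_theoremB_of_7_2_1_of_7_2_2_of_7_2_3 hB h721
    (CDT_theorem_7_2_2_of_lift_of_three_facts hES hF hC hlift) h723

/-- **BCDT, proof of Theorem A for a given `E / ℚ`: the three cases of the Introduction, the two
steps of case 1 ("first we prove that `ρ̄_{E,ℓ}` is modular and then that `ρ_{E,ℓ}` is modular"),
and "(3) ⇒ (2)" from Eichler–Shimura, Faltings and Carayol** — the unprimed
`isModular_of_theoremB_of_CDT721_lift_723_of_three_facts` (`CDTTheorem722ThreeFactsProofs`) with its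
per-curve input `h27` discharged (`isModular_of_theoremB_of_CDT721_722_723'`).  Inputs: Theorem B,
CDT Thm. 7.2.1, the `5`-adic lifting statement `hlift` of CDT Thm. 7.2.2 (proof, pp. 553–554), the
three classical facts, CDT Lemma 7.2.3 (modularity); nothing about this curve.
[cite: BCDTJAMS2001, Introduction (proof of Theorem A, cases 1–3; (3) ⇒ (2))]
[cite: ConradDiamondTaylor1999, Thm. 7.2.2 (proof, pp. 553–554)] -/
theorem isModular_of_theoremB_of_CDT721_lift_723_of_three_facts' (hB : theoremB)
    (h721 : CDT_theorem_7_2_1)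
    (hlift : ∀ (W : WeierstrassCurve ℚ) [W.IsElliptic] (ρ : ModPGaloisRep ℚ (ZMod 5) 2),
      W.IsTorsionGaloisRep 5 ρ → ρ.IsAbsIrreducibleOverSqrt 5 → ρ.IsModular →
      W.IsModularGaloisRepTate 5)
    (hES : eichlerShimuraConstruction)
    (hF : WeierstrassCurve.isIsogenous_iff_frobeniusTrace_eq)
    (hC : ∀ (N : ℕ) [NeZero N], IsNewformOf.level_eq_conductorNorm (N := N))
    (h723 : CDT_lemma_7_2_3_isModular)
    (W : WeierstrassCurve ℚ) [W.IsElliptic] [NeZero (W.conductorNorm ℤ)] : IsModular W :=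
  isModular_of_theoremB_of_CDT721_722_723' hB h721
    (CDT_theorem_7_2_2_of_lift_of_three_facts hES hF hC hlift) h723 W

/-- **BCDT Theorem A** (`exists_isNewformOf`) **from Theorem B, CDT Thm. 7.2.1, the `5`-adic
lifting step of CDT Thm. 7.2.2, Eichler–Shimura, Faltings, Carayol and CDT Lemma 7.2.3
(modularity)** — the three cases of the Introduction for every curve, Theorem B kept whole, no
`3`–`5` switch, no auxiliary curve, no conductor or Galois-module input:
`exists_isNewformOf_of_theoremB_of_CDT721_722_723` with `CDT_theorem_7_2_2` supplied by
`CDT_theorem_7_2_2_of_lift_of_three_facts`.  Every input is a catalogued named fact of the tree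
except the printed `5`-adic lifting statement `hlift` (CDT Thm. 7.2.2, proof, pp. 553–554:
Thm. 7.1.1 = Thm. 5.4.2 (`R = T`) with Lemma 7.1.3, §2.2, §B.2, Prop. B.4.2).  The discharge of
`exists_isNewformOf_of_theoremB_of_CDT721_lift_723_of_ogg3two_of_three_facts`
(`CDTTheorem722ThreeFactsProofs`) and of `…_of_ogg3two_of_facts` (`BCDTTheoremACasesFactsProofs`).
[cite: BCDTJAMS2001, Theorem A; Introduction (proof of Theorem A, cases 1–3; (3) ⇒ (2))] -/
theorem exists_isNewformOf_of_theoremB_of_CDT721_lift_723_of_three_facts (hB : theoremB)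
    (h721 : CDT_theorem_7_2_1)
    (hlift : ∀ (W : WeierstrassCurve ℚ) [W.IsElliptic] (ρ : ModPGaloisRep ℚ (ZMod 5) 2),
      W.IsTorsionGaloisRep 5 ρ → ρ.IsAbsIrreducibleOverSqrt 5 → ρ.IsModular →
      W.IsModularGaloisRepTate 5)
    (hES : eichlerShimuraConstruction)
    (hF : WeierstrassCurve.isIsogenous_iff_frobeniusTrace_eq)
    (hC : ∀ (N : ℕ) [NeZero N], IsNewformOf.level_eq_conductorNorm (N := N))
    (h723 : CDT_lemma_7_2_3_isModular) :
    EllipticCurves.ModularForms.exists_isNewformOf :=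
  exists_isNewformOf_of_theoremB_of_CDT721_722_723 hB h721
    (CDT_theorem_7_2_2_of_lift_of_three_facts hES hF hC hlift) h723

/-- **Theorem A from Serre's conjecture (3.2.3) at `p = 5` in place of Theorem B**, with the finer
inputs CDT Thm. 7.2.1, the `5`-adic lifting step of Thm. 7.2.2, Eichler–Shimura, Faltings,
Carayol, Lemma 7.2.3 (`theoremB_of_exists_newform_of_odd_irreducible`, then
`exists_isNewformOf_of_theoremB_of_CDT721_lift_723_of_three_facts`).
[cite: BCDTJAMS2001, Introduction; Theorem A] -/
theorem exists_isNewformOf_of_serre_of_CDT721_lift_723_of_three_facts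
    (hSerre : ∀ (k : Type) [Field k] [TopologicalSpace k] [DiscreteTopology k],
      exists_newform_of_odd_irreducible (p := 5) (k := k))
    (h721 : CDT_theorem_7_2_1)
    (hlift : ∀ (W : WeierstrassCurve ℚ) [W.IsElliptic] (ρ : ModPGaloisRep ℚ (ZMod 5) 2),
      W.IsTorsionGaloisRep 5 ρ → ρ.IsAbsIrreducibleOverSqrt 5 → ρ.IsModular →
      W.IsModularGaloisRepTate 5)
    (hES : eichlerShimuraConstruction)
    (hF : WeierstrassCurve.isIsogenous_iff_frobeniusTrace_eq)
    (hC : ∀ (N : ℕ) [NeZero N], IsNewformOf.level_eq_conductorNorm (N := N))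
    (h723 : CDT_lemma_7_2_3_isModular) :
    EllipticCurves.ModularForms.exists_isNewformOf :=
  exists_isNewformOf_of_theoremB_of_CDT721_lift_723_of_three_facts
    (theoremB_of_exists_newform_of_odd_irreducible hSerre) h721 hlift hES hF hC h723

end Literature.NumberTheory.Automorphic.BCDT

namespace Literature.NumberTheory.Automorphic

open WeierstrassCurve GaloisRepresentations EllipticCurves EllipticCurves.ModularForms

/-! ## lang.S33 on catalogued named facts alone -/

/-- **lang.S33 from Theorem B and CDT Thms. 7.1.2, 7.2.2 — nothing else**: granted those three
named facts, every integral Weierstrass model `E` with `Δ_E ≠ 0` has a level `N ≥ 1` and a cusp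
form `f ∈ S₂(Γ₀(N))` with `a_p(f) = p + 1 - #E(𝔽_p)` for every prime `p ∤ N Δ_E`
(`exists_cuspForm_coeff_eq_frobeniusTrace_of_exists_isNewformOf`, `LangWave0Proofs` Part 2, applied
to `BCDT.exists_isNewformOf_of_theoremB_CDT712_722`, `CDTTheorem712ConductorStepProofs`: BCDT §2.2,
"Theorem A follows from Theorem B and Theorem 7.2.4 of [CDT]", 7.2.4 being "immediate from
Theorem 7.1.2" and 7.2.2).  The discharge of
`exists_cuspForm_coeff_eq_frobeniusTrace_of_theoremB_of_CDT712_722` (`CDTModularityProofs`, there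
on Ogg–Saito in Galois form at `ℓ = 5`). [cite: BCDTJAMS2001, Theorem A; Theorem 2.2.2] -/
theorem exists_cuspForm_coeff_eq_frobeniusTrace_of_theoremB_CDT712_722 (hB : BCDT.theoremB)
    (h712 : BCDT.CDT_theorem_7_1_2) (h722 : BCDT.CDT_theorem_7_2_2) :
    exists_cuspForm_coeff_eq_frobeniusTrace :=
  exists_cuspForm_coeff_eq_frobeniusTrace_of_exists_isNewformOf
    (BCDT.exists_isNewformOf_of_theoremB_CDT712_722 hB h712 h722)

/-- **lang.S33 from Theorem B, CDT Thm. 7.2.1, Thm. 7.2.2 and Lemma 7.2.3 (modularity) — nothing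
else** — by the three cases of BCDT's Introduction, without the `3`–`5` switch
(`exists_cuspForm_coeff_eq_frobeniusTrace_of_exists_isNewformOf` applied to
`BCDT.exists_isNewformOf_of_theoremB_of_CDT721_722_723`).  The discharge of
`exists_cuspForm_coeff_eq_frobeniusTrace_of_theoremB_of_CDT721_722_723_of_ogg3[two]`; compare
`exists_cuspForm_coeff_eq_frobeniusTrace_of_theoremB_CDT721_722_723_switch`
(`CDTTheorem712ConductorStepProofs`), which carries the switch as a fifth input.
[cite: BCDTJAMS2001, Theorem A; Introduction (proof of Theorem A, cases 1–3)] -/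
theorem exists_cuspForm_coeff_eq_frobeniusTrace_of_theoremB_of_CDT721_722_723 (hB : BCDT.theoremB)
    (h721 : BCDT.CDT_theorem_7_2_1) (h722 : BCDT.CDT_theorem_7_2_2)
    (h723 : BCDT.CDT_lemma_7_2_3_isModular) :
    exists_cuspForm_coeff_eq_frobeniusTrace :=
  exists_cuspForm_coeff_eq_frobeniusTrace_of_exists_isNewformOf
    (BCDT.exists_isNewformOf_of_theoremB_of_CDT721_722_723 hB h721 h722 h723)

/-- **lang.S33, `L`-series form** (`exists_cuspForm_qExpansion_coeff_eq_lFunction`: some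
`f ∈ S₂(Γ₀(N))`, `N ≥ 1`, with `aₙ(f) = aₙ(E)` for all `n`) **from the same four named facts**
(`exists_cuspForm_qExpansion_coeff_eq_lFunction_of_exists_isNewformOf`, `LangWave0Proofs` Part 4,
applied to `BCDT.exists_isNewformOf_of_theoremB_of_CDT721_722_723`).
[cite: BCDTJAMS2001, Theorem A and Introduction (2)] -/
theorem exists_cuspForm_qExpansion_coeff_eq_lFunction_of_theoremB_of_CDT721_722_723
    (hB : BCDT.theoremB) (h721 : BCDT.CDT_theorem_7_2_1) (h722 : BCDT.CDT_theorem_7_2_2)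
    (h723 : BCDT.CDT_lemma_7_2_3_isModular) :
    exists_cuspForm_qExpansion_coeff_eq_lFunction :=
  exists_cuspForm_qExpansion_coeff_eq_lFunction_of_exists_isNewformOf
    (BCDT.exists_isNewformOf_of_theoremB_of_CDT721_722_723 hB h721 h722 h723)

/-- **lang.S33 from Serre's conjecture (3.2.3) at `p = 5`, CDT Thm. 7.2.1, Thm. 7.2.2 and Lemma
7.2.3 (modularity) — nothing else** (Theorem B replaced by Serre–Khare–Wintenberger at `p = 5`,
`BCDT.exists_isNewformOf_of_serre_of_CDT721_722_723`).  The discharge of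
`exists_cuspForm_coeff_eq_frobeniusTrace_of_serre_of_CDT721_722_723_of_ogg3[two]`.
[cite: BCDTJAMS2001, Theorem A; Introduction] -/
theorem exists_cuspForm_coeff_eq_frobeniusTrace_of_serre_of_CDT721_722_723
    (hSerre : ∀ (k : Type) [Field k] [TopologicalSpace k] [DiscreteTopology k],
      exists_newform_of_odd_irreducible (p := 5) (k := k))
    (h721 : BCDT.CDT_theorem_7_2_1) (h722 : BCDT.CDT_theorem_7_2_2)
    (h723 : BCDT.CDT_lemma_7_2_3_isModular) :
    exists_cuspForm_coeff_eq_frobeniusTrace :=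
  exists_cuspForm_coeff_eq_frobeniusTrace_of_exists_isNewformOf
    (BCDT.exists_isNewformOf_of_serre_of_CDT721_722_723 hSerre h721 h722 h723)

/-! ## lang.S33 with CDT Thm. 7.2.2 unfolded -/

/-- **lang.S33 from Theorem B, CDT Thm. 7.2.1, the `5`-adic lifting step of CDT Thm. 7.2.2,
Eichler–Shimura, Faltings, Carayol and CDT Lemma 7.2.3 (modularity)** — by the three cases of
BCDT's Introduction, "(3) ⇒ (2)" proved from the three classical facts, Deligne–Serre (2.7.2) and
Ogg's formula at `p = 3` proved in the tree
(`exists_cuspForm_coeff_eq_frobeniusTrace_of_exists_isNewformOf` applied to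
`BCDT.exists_isNewformOf_of_theoremB_of_CDT721_lift_723_of_three_facts`).  The discharge of
`exists_cuspForm_coeff_eq_frobeniusTrace_of_theoremB_of_CDT721_lift_723_of_ogg3two_of_facts`
(`BCDTTheoremACasesFactsProofs`).
[cite: BCDTJAMS2001, Theorem A; Introduction (proof of Theorem A, cases 1–3; (3) ⇒ (2))] -/
theorem exists_cuspForm_coeff_eq_frobeniusTrace_of_theoremB_of_CDT721_lift_723_of_three_facts
    (hB : BCDT.theoremB) (h721 : BCDT.CDT_theorem_7_2_1)
    (hlift : ∀ (W : WeierstrassCurve ℚ) [W.IsElliptic] (ρ : ModPGaloisRep ℚ (ZMod 5) 2),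
      W.IsTorsionGaloisRep 5 ρ → ρ.IsAbsIrreducibleOverSqrt 5 → ρ.IsModular →
      W.IsModularGaloisRepTate 5)
    (hES : eichlerShimuraConstruction)
    (hF : WeierstrassCurve.isIsogenous_iff_frobeniusTrace_eq)
    (hC : ∀ (N : ℕ) [NeZero N], IsNewformOf.level_eq_conductorNorm (N := N))
    (h723 : BCDT.CDT_lemma_7_2_3_isModular) :
    exists_cuspForm_coeff_eq_frobeniusTrace :=
  exists_cuspForm_coeff_eq_frobeniusTrace_of_exists_isNewformOf
    (BCDT.exists_isNewformOf_of_theoremB_of_CDT721_lift_723_of_three_facts hB h721 hlift hES hF hC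
      h723)

/-- **lang.S33, `L`-series form, from the same inputs**
(`exists_cuspForm_qExpansion_coeff_eq_lFunction_of_exists_isNewformOf` applied to
`BCDT.exists_isNewformOf_of_theoremB_of_CDT721_lift_723_of_three_facts`).
[cite: BCDTJAMS2001, Theorem A and Introduction (2)] -/
theorem exists_cuspForm_qExpansion_coeff_eq_lFunction_of_theoremB_of_CDT721_lift_723_of_three_facts
    (hB : BCDT.theoremB) (h721 : BCDT.CDT_theorem_7_2_1)
    (hlift : ∀ (W : WeierstrassCurve ℚ) [W.IsElliptic] (ρ : ModPGaloisRep ℚ (ZMod 5) 2),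
      W.IsTorsionGaloisRep 5 ρ → ρ.IsAbsIrreducibleOverSqrt 5 → ρ.IsModular →
      W.IsModularGaloisRepTate 5)
    (hES : eichlerShimuraConstruction)
    (hF : WeierstrassCurve.isIsogenous_iff_frobeniusTrace_eq)
    (hC : ∀ (N : ℕ) [NeZero N], IsNewformOf.level_eq_conductorNorm (N := N))
    (h723 : BCDT.CDT_lemma_7_2_3_isModular) :
    exists_cuspForm_qExpansion_coeff_eq_lFunction :=
  exists_cuspForm_qExpansion_coeff_eq_lFunction_of_exists_isNewformOf
    (BCDT.exists_isNewformOf_of_theoremB_of_CDT721_lift_723_of_three_facts hB h721 hlift hES hF hC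
      h723)

/-- **lang.S33 from Serre's conjecture (3.2.3) at `p = 5`, CDT Thm. 7.2.1, the `5`-adic lifting
step of Thm. 7.2.2, Eichler–Shimura, Faltings, Carayol and Lemma 7.2.3 (modularity)** (Theorem B
replaced by Serre–Khare–Wintenberger at `p = 5`,
`BCDT.exists_isNewformOf_of_serre_of_CDT721_lift_723_of_three_facts`).  The discharge of
`exists_cuspForm_coeff_eq_frobeniusTrace_of_serre_of_CDT721_lift_723_of_ogg3two_of_facts`.
[cite: BCDTJAMS2001, Theorem A; Introduction] -/
theorem exists_cuspForm_coeff_eq_frobeniusTrace_of_serre_of_CDT721_lift_723_of_three_facts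
    (hSerre : ∀ (k : Type) [Field k] [TopologicalSpace k] [DiscreteTopology k],
      exists_newform_of_odd_irreducible (p := 5) (k := k))
    (h721 : BCDT.CDT_theorem_7_2_1)
    (hlift : ∀ (W : WeierstrassCurve ℚ) [W.IsElliptic] (ρ : ModPGaloisRep ℚ (ZMod 5) 2),
      W.IsTorsionGaloisRep 5 ρ → ρ.IsAbsIrreducibleOverSqrt 5 → ρ.IsModular →
      W.IsModularGaloisRepTate 5)
    (hES : eichlerShimuraConstruction)
    (hF : WeierstrassCurve.isIsogenous_iff_frobeniusTrace_eq)
    (hC : ∀ (N : ℕ) [NeZero N], IsNewformOf.level_eq_conductorNorm (N := N))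
    (h723 : BCDT.CDT_lemma_7_2_3_isModular) :
    exists_cuspForm_coeff_eq_frobeniusTrace :=
  exists_cuspForm_coeff_eq_frobeniusTrace_of_exists_isNewformOf
    (BCDT.exists_isNewformOf_of_serre_of_CDT721_lift_723_of_three_facts hSerre h721 hlift hES hF hC
      h723)

end Literature.NumberTheory.Automorphic
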